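import Literature.Analysis.SpecialFunctions.GammaStirlingUniform
import Literature.Analysis.SpecialFunctions.GammaProductBounds
import Literature.Analysis.SpecialFunctions.GammaVerticalRatio
import Mathlib.Analysis.SpecialFunctions.Trigonometric.Bounds
import HarnessLib

/-!
# Stirling's formula on vertical lines: `|Γ(x + iu)| ≍ |u|^{x − 1/2} e^{−π|u|/2}`, uniformly for
# `x` in a compact interval of ANY reals, `|u| ≥ 1`

Topic `Literature/Analysis/SpecialFunctions`, companion of `GammaStirlingUniform.lean` (the
uniform first-order Stirling formula for `log ‖Γ(w)‖` on `Re w > 0`,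
`GammaStirling.abs_log_norm_Gamma_sub_le`), `GammaStirlingOrder.lean` and
`GammaProductBounds.lean` (crude two-sided bounds with the right exponential `e^{−π|u|/2}` but
polynomial factors `(1+|u|)^{1/2}`, `(1+|u|)^{3/2}` in place of `|u|^{x−1/2}`), and
`GammaVerticalRatio.lean` (`‖Γ(x+δ+iu)‖ ≤ K(1+|u|)^δ ‖Γ(x+iu)‖` for `0 < x ≤ 1`, `0 ≤ δ ≤ 1` only).
Everything here is PROVED; there are no definitions and no named facts (D-0026).

This file upgrades these to the genuine vertical Stirling estimate with the SHARP power of `|u|`,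
for real parts in an arbitrary compact interval `[a, b] ⊂ ℝ` (negative real parts included, by
the recurrence `Γ(z) = Γ(z + n)/∏_{k<n}(z + k)`):

* `GammaStirling.abs_log_norm_Gamma_vertical_sub_le_of_pos` — for `x > 0`, `|u| ≥ 1`:
  `|log ‖Γ(x+iu)‖ − ((x − ½) log|u| − π|u|/2 + ½ log 2π)| ≤ (x + ½)x²/2 + πx/2 + x + ¼`;
* `GammaStirling.abs_log_norm_Gamma_vertical_sub_le` — any real `x`, `n` with `x + n > 0`:
  the same with error `E(x + n) + Σ_{k<n} (x + k)²/2`;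
* `GammaStirling.exists_abs_log_norm_Gamma_vertical_sub_le` — **uniform form**: for `a ≤ b`
  there is `C` with `|log ‖Γ(x+iu)‖ − ((x − ½) log|u| − π|u|/2)| ≤ C` for `x ∈ [a, b]`, `|u| ≥ 1`;
* `GammaStirling.exists_norm_Gamma_vertical_le` / `…_ge` — `c |u|^{x−1/2} e^{−π|u|/2} ≤ ‖Γ(x+iu)‖
  ≤ C |u|^{x−1/2} e^{−π|u|/2}` uniformly for `x ∈ [a, b]`, `|u| ≥ 1`;
* `GammaStirling.exists_norm_Gamma_vertical_ratio_le` — `‖Γ(x₁+iu)‖ ≤ C |u|^{x₁−x₂} ‖Γ(x₂+iu)‖`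
  for `x₁, x₂ ∈ [a, b]`, `|u| ≥ 1` (Titchmarsh (4.12.3)).

These are the `Γ`-factor inputs of functional-equation ("convexity") bounds for `L`-functions on
vertical lines and of contour-shift estimates with Γ-kernels — e.g. A. R. Booker, Ann. of Math.
158 (2003), p. 1095, display (18): on `Re s = 3/2 + Δ` "the integrand is `O(|s|^{3/2−Δ})`,
independently of `δ`" needs `|Γ(Δ + it)| ≪ |t|^{Δ−1/2} e^{−π|t|/2}` with the sharp exponent.

Proof of the `x > 0` case from `abs_log_norm_Gamma_sub_le` (`w = x + iu`, `|w| ≥ |u| ≥ 1`):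
`log ‖w‖ − log |u| = ½ log(1 + x²/u²) ∈ [0, x²/2]`; `arg w = arcsin(u/‖w‖)`
(`Complex.arg_of_re_nonneg`) and `arcsin(|u|/‖w‖) = π/2 − arcsin(x/‖w‖)`, so
`u · arg w = |u|(π/2 − arcsin(x/‖w‖))` with `0 ≤ |u| arcsin(x/‖w‖) ≤ |u| (π/2)(x/‖w‖) ≤ πx/2`
(Jordan's inequality `Real.mul_le_sin`); the Stirling remainder `(1/12)(1/‖w‖² + π/(2‖w‖)) ≤ ¼`.

## References

* E. C. Titchmarsh, *The Theory of the Riemann Zeta-Function*, 2nd ed. (1986), §4.12,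
  (4.12.2)–(4.12.3). [Titchmarsh1986]
* E. T. Whittaker, G. N. Watson, *A Course of Modern Analysis*, 4th ed. (1927), §12.33, §13.6.
* A. R. Booker, *Poles of Artin L-functions and the strong Artin conjecture*, Ann. of Math. 158
  (2003), p. 1095 (18). [Booker2003]

## Mathlib / tree search

Mathlib: no complex Stirling formula (`Mathlib.Analysis.SpecialFunctions.Stirling` is `n!` only);
`Complex.arg_of_re_nonneg`, `Real.mul_le_sin`, `Real.arccos_eq_arcsin`,
`Real.arccos_eq_pi_div_two_sub_arcsin`, `Complex.Gamma_ne_zero`. Tree: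
`GammaStirling.abs_log_norm_Gamma_sub_le` (`GammaStirlingUniform`),
`inv_Gamma_eq_prod_mul_inv_Gamma_add_nat` (`GammaProductBounds`), `norm_Gamma_le_exp`
(`GammaStirlingOrder`, crude), `GammaRatio.norm_Gamma_shift_le` (`GammaVerticalRatio`, crude
range); `lean search 'x - 1 / 2.*log|vertical.*Stirling'`: nothing sharp before this file.
-/

noncomputable section

open Complex Real Set Filter Topology Finset

namespace Literature.Analysis.SpecialFunctions

namespace GammaStirling

/-! ### Elementary facts about `w = x + iu` -/

/-- `|u| ≤ ‖x + iu‖`. [folklore] -/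
theorem abs_le_norm_ofReal_add_mul_I (x u : ℝ) : |u| ≤ ‖(x : ℂ) + u * I‖ := by
  have h := Complex.abs_im_le_norm ((x : ℂ) + u * I)
  simpa using h

/-- `0 ≤ log ‖x + iu‖ − log |u| ≤ x²/(2u²)` for `u ≠ 0`. [folklore] -/
theorem log_norm_sub_log_abs_mem {x u : ℝ} (hu : u ≠ 0) :
    0 ≤ Real.log ‖(x : ℂ) + u * I‖ - Real.log |u| ∧
      Real.log ‖(x : ℂ) + u * I‖ - Real.log |u| ≤ x ^ 2 / (2 * u ^ 2) := by
  have hu0 : 0 < |u| := abs_pos.mpr hu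
  have hu2 : 0 < u ^ 2 := by positivity
  have hw0 : 0 < ‖(x : ℂ) + u * I‖ := hu0.trans_le (abs_le_norm_ofReal_add_mul_I x u)
  have hsq := GammaRatio.norm_sq_eq x u
  -- `2 (log ‖w‖ − log |u|) = log (1 + x²/u²)`
  have hkey : 2 * (Real.log ‖(x : ℂ) + u * I‖ - Real.log |u|) = Real.log (1 + x ^ 2 / u ^ 2) := by
    have h1 : Real.log (‖(x : ℂ) + u * I‖ ^ 2) = 2 * Real.log ‖(x : ℂ) + u * I‖ := by
      rw [Real.log_pow]; norm_num
    have h2 : Real.log (u ^ 2) = 2 * Real.log |u| := by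
      rw [← sq_abs, Real.log_pow]; norm_num
    have h3 : ‖(x : ℂ) + u * I‖ ^ 2 = u ^ 2 * (1 + x ^ 2 / u ^ 2) := by
      rw [hsq]; field_simp; ring
    have h4 : Real.log (‖(x : ℂ) + u * I‖ ^ 2) = Real.log (u ^ 2) + Real.log (1 + x ^ 2 / u ^ 2) := by
      rw [h3, Real.log_mul hu2.ne' (by positivity)]
    linarith
  have hy0 : 0 ≤ x ^ 2 / u ^ 2 := by positivity
  constructor
  · have : 0 ≤ Real.log (1 + x ^ 2 / u ^ 2) := Real.log_nonneg (by linarith)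
    linarith
  · have : Real.log (1 + x ^ 2 / u ^ 2) ≤ x ^ 2 / u ^ 2 := by
      have h := Real.log_le_sub_one_of_pos (by linarith : 0 < 1 + x ^ 2 / u ^ 2)
      linarith
    have h5 : x ^ 2 / (2 * u ^ 2) = (x ^ 2 / u ^ 2) / 2 := by ring
    rw [h5]; linarith

/-- For `x > 0`: `u · arg(x + iu) = |u| (π/2 − arcsin (x/‖x + iu‖))`. [folklore] -/
theorem im_mul_arg_eq {x u : ℝ} (hx : 0 < x) :
    u * Complex.arg ((x : ℂ) + u * I) =
      |u| * (π / 2 - Real.arcsin (x / ‖(x : ℂ) + u * I‖)) := by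
  set w : ℂ := (x : ℂ) + u * I with hw
  have hw0 : 0 < ‖w‖ := by
    have : (0 : ℝ) < |x| := abs_pos.mpr hx.ne'
    exact this.trans_le (by simpa [hw] using Complex.abs_re_le_norm w)
  have hre : w.re = x := by simp [hw]
  have him : w.im = u := by simp [hw]
  have harg : Complex.arg w = Real.arcsin (u / ‖w‖) := by
    rw [Complex.arg_of_re_nonneg (by rw [hre]; exact hx.le), him]
  have hsq : ‖w‖ ^ 2 = x ^ 2 + u ^ 2 := GammaRatio.norm_sq_eq x u
  -- `arcsin (|u|/‖w‖) = π/2 − arcsin (x/‖w‖)`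
  have hxw0 : 0 ≤ x / ‖w‖ := by positivity
  have hxw1 : x / ‖w‖ ≤ 1 := by
    rw [div_le_one hw0]
    have h := Complex.abs_re_le_norm w
    have hre' : w.re = x := by simp [hw]
    rwa [hre', abs_of_pos hx] at h
  have hcompl : Real.arcsin (|u| / ‖w‖) = π / 2 - Real.arcsin (x / ‖w‖) := by
    rw [← Real.arccos_eq_pi_div_two_sub_arcsin, Real.arccos_eq_arcsin hxw0]
    congr 1
    have h1 : 1 - (x / ‖w‖) ^ 2 = (|u| / ‖w‖) ^ 2 := by
      rw [div_pow, div_pow, sq_abs]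
      field_simp
      nlinarith [hsq]
    rw [h1, Real.sqrt_sq (by positivity)]
  rcases le_or_gt 0 u with hu | hu
  · rw [harg, abs_of_nonneg hu, ← hcompl, abs_of_nonneg hu]
  · rw [harg, abs_of_neg hu, show u / ‖w‖ = -(-u / ‖w‖) by ring, Real.arcsin_neg, ← abs_of_neg hu,
      hcompl]
    rw [abs_of_neg hu]; ring

/-- For `x > 0`: `0 ≤ π|u|/2 − u · arg(x + iu) ≤ πx/2`. [folklore] -/
theorem pi_mul_abs_div_two_sub_im_mul_arg_mem {x u : ℝ} (hx : 0 < x) :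
    0 ≤ π * |u| / 2 - u * Complex.arg ((x : ℂ) + u * I) ∧
      π * |u| / 2 - u * Complex.arg ((x : ℂ) + u * I) ≤ π * x / 2 := by
  rw [im_mul_arg_eq hx]
  set w : ℂ := (x : ℂ) + u * I with hw
  have hw0 : 0 < ‖w‖ := by
    have : (0 : ℝ) < |x| := abs_pos.mpr hx.ne'
    exact this.trans_le (by simpa [hw] using Complex.abs_re_le_norm w)
  have hxw0 : 0 ≤ x / ‖w‖ := by positivity
  have hxw1 : x / ‖w‖ ≤ 1 := by
    rw [div_le_one hw0]
    have h := Complex.abs_re_le_norm w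
    have hre' : w.re = x := by simp [hw]
    rwa [hre', abs_of_pos hx] at h
  have huw : |u| ≤ ‖w‖ := by simpa [hw] using abs_le_norm_ofReal_add_mul_I x u
  have ha0 : 0 ≤ Real.arcsin (x / ‖w‖) := Real.arcsin_nonneg.mpr hxw0
  -- Jordan's inequality `(2/π) θ ≤ sin θ` at `θ = arcsin (x/‖w‖)`: `arcsin y ≤ (π/2) y`
  have ha1 : Real.arcsin (x / ‖w‖) ≤ π / 2 * (x / ‖w‖) := by
    have hJ := Real.mul_le_sin ha0 (Real.arcsin_le_pi_div_two _)
    rw [Real.sin_arcsin (by linarith) hxw1] at hJ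
    have hπ : 0 < π := Real.pi_pos
    calc Real.arcsin (x / ‖w‖) = π / 2 * (2 / π * Real.arcsin (x / ‖w‖)) := by field_simp
      _ ≤ π / 2 * (x / ‖w‖) := mul_le_mul_of_nonneg_left hJ (by positivity)
  have hsimp : π * |u| / 2 - |u| * (π / 2 - Real.arcsin (x / ‖w‖)) = |u| * Real.arcsin (x / ‖w‖) := by
    ring
  rw [hsimp]
  refine ⟨mul_nonneg (abs_nonneg u) ha0, ?_⟩
  calc |u| * Real.arcsin (x / ‖w‖) ≤ |u| * (π / 2 * (x / ‖w‖)) :=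
        mul_le_mul_of_nonneg_left ha1 (abs_nonneg u)
    _ = π * x / 2 * (|u| / ‖w‖) := by ring
    _ ≤ π * x / 2 * 1 := by
        refine mul_le_mul_of_nonneg_left ((div_le_one hw0).mpr huw) (by positivity)
    _ = π * x / 2 := mul_one _

/-! ### The estimate for `x > 0` -/

/-- **Stirling on vertical lines, `x > 0`.** For `x > 0` and `|u| ≥ 1`,
`|log ‖Γ(x + iu)‖ − ((x − 1/2) log |u| − π|u|/2 + ½ log 2π)| ≤ (x + ½) x²/2 + πx/2 + x + ¼`
(from the uniform Stirling formula of the tree, `GammaStirling.abs_log_norm_Gamma_sub_le`, with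
`log ‖w‖ = log |u| + O(x²/u²)` and `u · arg w = π|u|/2 + O(x)`). [folklore] -/
theorem abs_log_norm_Gamma_vertical_sub_le_of_pos {x u : ℝ} (hx : 0 < x) (hu : 1 ≤ |u|) :
    |Real.log ‖Complex.Gamma ((x : ℂ) + u * I)‖ -
        ((x - 1 / 2) * Real.log |u| - π * |u| / 2 + Real.log (2 * π) / 2)| ≤
      (x + 1 / 2) * x ^ 2 / 2 + π * x / 2 + x + 1 / 4 := by
  set w : ℂ := (x : ℂ) + u * I with hw
  have hu0 : u ≠ 0 := by intro h; rw [h, abs_zero] at hu; linarith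
  have hre : w.re = x := by simp [hw]
  have him : w.im = u := by simp [hw]
  have hwu : |u| ≤ ‖w‖ := by simpa [hw] using abs_le_norm_ofReal_add_mul_I x u
  have hw1 : 1 ≤ ‖w‖ := hu.trans hwu
  have hS := abs_log_norm_Gamma_sub_le (w := w) (by rw [hre]; exact hx)
  rw [hre, him] at hS
  -- the remainder of the uniform Stirling formula is at most `1/4`
  have hrem : (1 / 12 : ℝ) * (1 / ‖w‖ ^ 2 + π / (2 * ‖w‖)) ≤ 1 / 4 := by
    have h1 : 1 / ‖w‖ ^ 2 ≤ 1 := by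
      rw [div_le_one (by positivity)]; nlinarith
    have h2 : π / (2 * ‖w‖) ≤ 2 := by
      rw [div_le_iff₀ (by positivity)]; nlinarith [Real.pi_lt_four]
    nlinarith
  obtain ⟨hE1l, hE1u⟩ := log_norm_sub_log_abs_mem (x := x) hu0
  obtain ⟨hE2l, hE2u⟩ := pi_mul_abs_div_two_sub_im_mul_arg_mem (u := u) hx
  have hE1u' : Real.log ‖(x : ℂ) + u * I‖ - Real.log |u| ≤ x ^ 2 / 2 :=
    hE1u.trans (div_le_div_of_nonneg_left (sq_nonneg x) (by norm_num)
      (by nlinarith [sq_abs u] : (2 : ℝ) ≤ 2 * u ^ 2))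
  -- abbreviations
  set E1 : ℝ := Real.log ‖(x : ℂ) + u * I‖ - Real.log |u| with hE1
  set E2 : ℝ := π * |u| / 2 - u * Complex.arg ((x : ℂ) + u * I) with hE2
  set L : ℝ := Real.log ‖Complex.Gamma w‖ with hL
  set M : ℝ := (x - 1 / 2) * Real.log ‖w‖ - u * Complex.arg w - x + Real.log (2 * π) / 2 with hM
  set T : ℝ := (x - 1 / 2) * Real.log |u| - π * |u| / 2 + Real.log (2 * π) / 2 with hT
  have hMT : M - T = (x - 1 / 2) * E1 + E2 - x := by
    rw [hM, hT, hE1, hE2, hw]; ring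
  have h1 : |L - M| ≤ 1 / 4 := hS.trans hrem
  have h2 : |(x - 1 / 2) * E1| ≤ (x + 1 / 2) * x ^ 2 / 2 := by
    rw [abs_mul]
    have : |x - 1 / 2| ≤ x + 1 / 2 := abs_sub_le_iff.mpr ⟨by linarith, by linarith⟩
    calc |x - 1 / 2| * |E1| ≤ (x + 1 / 2) * (x ^ 2 / 2) := by
          rw [abs_of_nonneg hE1l]
          exact mul_le_mul this hE1u' hE1l (by linarith)
      _ = _ := by ring
  have h3 : |E2 - x| ≤ π * x / 2 + x := by
    rw [abs_sub_le_iff]; constructor <;> nlinarith [Real.pi_pos]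
  have hsplit : L - T = (L - M) + ((x - 1 / 2) * E1) + (E2 - x) := by
    rw [show L - T = (L - M) + (M - T) by ring, hMT]; ring
  have hA := abs_add_le (L - M + (x - 1 / 2) * E1) (E2 - x)
  have hB := abs_add_le (L - M) ((x - 1 / 2) * E1)
  rw [hsplit]
  linarith

/-! ### All real `x`: the recurrence -/

/-- `‖Γ(z)‖ = ‖Γ(z + n)‖ / ∏_{k<n} ‖z + k‖` when `im z ≠ 0` (no poles are met). [folklore] -/
theorem norm_Gamma_eq_norm_Gamma_add_nat_div {z : ℂ} (hz : z.im ≠ 0) (n : ℕ) :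
    ‖Complex.Gamma z‖ = ‖Complex.Gamma (z + n)‖ / ∏ k ∈ Finset.range n, ‖z + k‖ := by
  have hid := inv_Gamma_eq_prod_mul_inv_Gamma_add_nat z n
  have hprod : ∏ k ∈ Finset.range n, (z + k) ≠ 0 := by
    rw [Finset.prod_ne_zero_iff]
    intro k _ h0
    have := congrArg Complex.im h0
    simp at this
    exact hz this
  have heq : Complex.Gamma z = Complex.Gamma (z + n) / ∏ k ∈ Finset.range n, (z + k) := by
    have h2 : Complex.Gamma z = ((Complex.Gamma z)⁻¹)⁻¹ := (inv_inv _).symm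
    rw [h2, hid, mul_inv, inv_inv, div_eq_mul_inv, mul_comm]
  rw [heq, norm_div, norm_prod]

/-- **Stirling on vertical lines, any real `x`, explicit.** For real `x`, `n : ℕ` with `x + n > 0`
and `|u| ≥ 1`,
`|log ‖Γ(x + iu)‖ − ((x − ½) log |u| − π|u|/2 + ½ log 2π)| ≤ E(x + n) + Σ_{k<n} (x + k)²/2`,
`E(y) = (y + ½) y²/2 + πy/2 + y + ¼` (recurrence `Γ(z) = Γ(z + n)/∏_{k<n}(z + k)` and
`log ‖x + k + iu‖ = log |u| + O((x + k)²/u²)`). [folklore] -/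
theorem abs_log_norm_Gamma_vertical_sub_le {x u : ℝ} {n : ℕ} (hxn : 0 < x + n) (hu : 1 ≤ |u|) :
    |Real.log ‖Complex.Gamma ((x : ℂ) + u * I)‖ -
        ((x - 1 / 2) * Real.log |u| - π * |u| / 2 + Real.log (2 * π) / 2)| ≤
      ((x + n + 1 / 2) * (x + n) ^ 2 / 2 + π * (x + n) / 2 + (x + n) + 1 / 4) +
        ∑ k ∈ Finset.range n, (x + k) ^ 2 / 2 := by
  have hu0 : u ≠ 0 := by intro h; rw [h, abs_zero] at hu; linarith
  set z : ℂ := (x : ℂ) + u * I with hz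
  have hzim : z.im ≠ 0 := by simpa [hz] using hu0
  have hzn : z + n = ((x + n : ℝ) : ℂ) + u * I := by rw [hz]; push_cast; ring
  have hzk : ∀ k : ℕ, z + k = ((x + k : ℝ) : ℂ) + u * I := fun k ↦ by rw [hz]; push_cast; ring
  -- logarithm of the recurrence
  have hpos : ∀ k : ℕ, 0 < ‖z + k‖ := fun k ↦ by
    rw [hzk]; exact (abs_pos.mpr hu0).trans_le (abs_le_norm_ofReal_add_mul_I _ u)
  have hΓn : Complex.Gamma (z + n) ≠ 0 := by
    rw [hzn]; exact Complex.Gamma_ne_zero_of_re_pos (by simpa using hxn)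
  have hlog : Real.log ‖Complex.Gamma z‖ =
      Real.log ‖Complex.Gamma (z + n)‖ - ∑ k ∈ Finset.range n, Real.log ‖z + k‖ := by
    rw [norm_Gamma_eq_norm_Gamma_add_nat_div hzim n, Real.log_div (norm_ne_zero_iff.mpr hΓn)
      (Finset.prod_pos fun k _ ↦ hpos k).ne', Real.log_prod]
    exact fun k _ ↦ (hpos k).ne'
  -- the estimate for `Γ(z + n)`
  have hmain := abs_log_norm_Gamma_vertical_sub_le_of_pos (x := x + n) (u := u) hxn hu
  rw [← hzn] at hmain
  -- the sum `Σ (log ‖z + k‖ − log |u|) ∈ [0, Σ (x+k)²/2]`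
  have hterm : ∀ k : ℕ, 0 ≤ Real.log ‖z + k‖ - Real.log |u| ∧
      Real.log ‖z + k‖ - Real.log |u| ≤ (x + k) ^ 2 / 2 := by
    intro k
    rw [hzk]
    obtain ⟨h1, h2⟩ := log_norm_sub_log_abs_mem (x := x + k) hu0
    exact ⟨h1, h2.trans (div_le_div_of_nonneg_left (sq_nonneg _) (by norm_num)
      (by nlinarith [sq_abs u] : (2 : ℝ) ≤ 2 * u ^ 2))⟩
  have hsum_lo : 0 ≤ ∑ k ∈ Finset.range n, (Real.log ‖z + k‖ - Real.log |u|) :=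
    Finset.sum_nonneg fun k _ ↦ (hterm k).1
  have hsum_hi : ∑ k ∈ Finset.range n, (Real.log ‖z + k‖ - Real.log |u|) ≤
      ∑ k ∈ Finset.range n, (x + k) ^ 2 / 2 := Finset.sum_le_sum fun k _ ↦ (hterm k).2
  have hsum_eq : ∑ k ∈ Finset.range n, Real.log ‖z + k‖ =
      n * Real.log |u| + ∑ k ∈ Finset.range n, (Real.log ‖z + k‖ - Real.log |u|) := by
    rw [Finset.sum_sub_distrib, Finset.sum_const, Finset.card_range, nsmul_eq_mul]; ring
  -- assemble
  set S : ℝ := ∑ k ∈ Finset.range n, (Real.log ‖z + k‖ - Real.log |u|) with hS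
  set Ln : ℝ := Real.log ‖Complex.Gamma (z + n)‖ with hLn
  set Tn : ℝ := (x + n - 1 / 2) * Real.log |u| - π * |u| / 2 + Real.log (2 * π) / 2 with hTn
  set T : ℝ := (x - 1 / 2) * Real.log |u| - π * |u| / 2 + Real.log (2 * π) / 2 with hT
  have hrel : Real.log ‖Complex.Gamma z‖ - T = (Ln - Tn) - S := by
    rw [hlog, hsum_eq, hT, hTn, hLn]; ring
  rw [hrel]
  calc |Ln - Tn - S| ≤ |Ln - Tn| + |S| := abs_sub _ _
    _ ≤ ((x + n + 1 / 2) * (x + n) ^ 2 / 2 + π * (x + n) / 2 + (x + n) + 1 / 4) +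
        ∑ k ∈ Finset.range n, (x + k) ^ 2 / 2 := by
        have : |S| ≤ ∑ k ∈ Finset.range n, (x + k) ^ 2 / 2 := by
          rw [abs_of_nonneg hsum_lo]; exact hsum_hi
        have hmain' : |Ln - Tn| ≤
            (x + n + 1 / 2) * (x + n) ^ 2 / 2 + π * (x + n) / 2 + (x + n) + 1 / 4 := by
          simpa [hLn, hTn] using hmain
        linarith


/-! ### Uniform packaged forms on a compact range of real parts -/

/-- Monotonicity of the error allowance `E(y) = (y + ½)y²/2 + πy/2 + y + ¼` on `[0, ∞)`.
[folklore] -/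
theorem stirlingErrorAllowance_mono {y Y : ℝ} (hy : 0 ≤ y) (hyY : y ≤ Y) :
    (y + 1 / 2) * y ^ 2 / 2 + π * y / 2 + y + 1 / 4 ≤
      (Y + 1 / 2) * Y ^ 2 / 2 + π * Y / 2 + Y + 1 / 4 := by
  have h1 : (y + 1 / 2) * y ^ 2 ≤ (Y + 1 / 2) * Y ^ 2 :=
    mul_le_mul (by linarith) (pow_le_pow_left₀ hy hyY 2) (by positivity) (by linarith)
  nlinarith [Real.pi_pos]

/-- **Stirling on vertical lines, uniformly for `x` in a compact interval.** For real `a ≤ b`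
there is `C` such that for all `x ∈ [a, b]` and `|u| ≥ 1`,
`|log ‖Γ(x + iu)‖ − ((x − ½) log |u| − π|u|/2)| ≤ C`
— i.e. `‖Γ(x + iu)‖ = |u|^{x − 1/2} e^{−π|u|/2} e^{O(1)}` (Titchmarsh (4.12.2); Whittaker–Watson
§13.6), any real parts, with no restriction to `x > 0`. [folklore] -/
theorem exists_abs_log_norm_Gamma_vertical_sub_le (a b : ℝ) :
    ∃ C : ℝ, 0 ≤ C ∧ ∀ x ∈ Icc a b, ∀ u : ℝ, 1 ≤ |u| →
      |Real.log ‖Complex.Gamma ((x : ℂ) + u * I)‖ - ((x - 1 / 2) * Real.log |u| - π * |u| / 2)| ≤ C := by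
  set n : ℕ := ⌈1 - a⌉₊ with hn
  set m : ℝ := max |a| |b| with hm
  have hm0 : 0 ≤ m := le_max_of_le_left (abs_nonneg a)
  set C : ℝ := ((|b| + n + 1 / 2) * (|b| + n) ^ 2 / 2 + π * (|b| + n) / 2 + (|b| + n) + 1 / 4) +
    ∑ k ∈ Finset.range n, (m + k) ^ 2 / 2 + |Real.log (2 * π) / 2| with hC
  refine ⟨C, by positivity, fun x hx u hu ↦ ?_⟩
  obtain ⟨hxa, hxb⟩ := hx
  have hxn : 0 < x + n := by have := Nat.le_ceil (1 - a); rw [hn]; linarith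
  have hmain := abs_log_norm_Gamma_vertical_sub_le (x := x) (u := u) hxn hu
  -- uniform bounds for the two error terms
  have hE := stirlingErrorAllowance_mono hxn.le (by linarith [le_abs_self b] : x + n ≤ |b| + n)
  have hxm : |x| ≤ m := by
    rw [hm]
    rcases le_total 0 x with h0 | h0
    · rw [abs_of_nonneg h0]; exact le_max_of_le_right (hxb.trans (le_abs_self b))
    · rw [abs_of_nonpos h0]; exact le_max_of_le_left (by linarith [neg_abs_le a])
  have hS : ∑ k ∈ Finset.range n, (x + k) ^ 2 / 2 ≤ ∑ k ∈ Finset.range n, (m + k) ^ 2 / 2 := by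
    refine Finset.sum_le_sum fun k _ ↦ ?_
    have h1 : |x + k| ≤ m + k := (abs_add_le _ _).trans (by rw [Nat.abs_cast]; linarith)
    have h2 : (x + k) ^ 2 ≤ (m + k) ^ 2 := by
      rw [← sq_abs (x + k)]
      exact pow_le_pow_left₀ (abs_nonneg _) h1 2
    linarith
  -- drop the constant `½ log 2π`
  set L : ℝ := Real.log ‖Complex.Gamma ((x : ℂ) + u * I)‖ with hL
  set T : ℝ := (x - 1 / 2) * Real.log |u| - π * |u| / 2 with hT
  have hsplit : L - T = (L - (T + Real.log (2 * π) / 2)) + Real.log (2 * π) / 2 := by ring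
  rw [hsplit]
  refine (abs_add_le _ _).trans ?_
  rw [hC]
  linarith

/-- **Upper bound** `‖Γ(x + iu)‖ ≤ C |u|^{x − 1/2} e^{−π|u|/2}` for `x ∈ [a, b]`, `|u| ≥ 1`
(sharp Stirling order in `|u|`, uniform in `x`). [folklore] -/
theorem exists_norm_Gamma_vertical_le (a b : ℝ) :
    ∃ C : ℝ, 0 < C ∧ ∀ x ∈ Icc a b, ∀ u : ℝ, 1 ≤ |u| →
      ‖Complex.Gamma ((x : ℂ) + u * I)‖ ≤ C * |u| ^ (x - 1 / 2) * Real.exp (-(π * |u|) / 2) := by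
  obtain ⟨C₀, -, hC₀⟩ := exists_abs_log_norm_Gamma_vertical_sub_le a b
  refine ⟨Real.exp C₀, Real.exp_pos _, fun x hx u hu ↦ ?_⟩
  have hu0 : 0 < |u| := by linarith
  have hΓ : Complex.Gamma ((x : ℂ) + u * I) ≠ 0 := by
    refine Complex.Gamma_ne_zero fun k h ↦ ?_
    have := congrArg Complex.im h
    simp at this
    rw [this, abs_zero] at hu; linarith
  have h := (abs_le.mp (hC₀ x hx u hu)).2
  have hlog : Real.log ‖Complex.Gamma ((x : ℂ) + u * I)‖ ≤
      C₀ + (x - 1 / 2) * Real.log |u| + (-(π * |u|) / 2) := by linarith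
  calc ‖Complex.Gamma ((x : ℂ) + u * I)‖
      = Real.exp (Real.log ‖Complex.Gamma ((x : ℂ) + u * I)‖) :=
        (Real.exp_log (norm_pos_iff.mpr hΓ)).symm
    _ ≤ Real.exp (C₀ + (x - 1 / 2) * Real.log |u| + (-(π * |u|) / 2)) := Real.exp_le_exp.mpr hlog
    _ = Real.exp C₀ * |u| ^ (x - 1 / 2) * Real.exp (-(π * |u|) / 2) := by
        rw [Real.exp_add, Real.exp_add, Real.rpow_def_of_pos hu0, mul_comm (Real.log |u|)]

/-- **Lower bound** `‖Γ(x + iu)‖ ≥ c |u|^{x − 1/2} e^{−π|u|/2}` (`c > 0`) for `x ∈ [a, b]`,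
`|u| ≥ 1`. [folklore] -/
theorem exists_norm_Gamma_vertical_ge (a b : ℝ) :
    ∃ c : ℝ, 0 < c ∧ ∀ x ∈ Icc a b, ∀ u : ℝ, 1 ≤ |u| →
      c * |u| ^ (x - 1 / 2) * Real.exp (-(π * |u|) / 2) ≤ ‖Complex.Gamma ((x : ℂ) + u * I)‖ := by
  obtain ⟨C₀, -, hC₀⟩ := exists_abs_log_norm_Gamma_vertical_sub_le a b
  refine ⟨Real.exp (-C₀), Real.exp_pos _, fun x hx u hu ↦ ?_⟩
  have hu0 : 0 < |u| := by linarith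
  have hΓ : Complex.Gamma ((x : ℂ) + u * I) ≠ 0 := by
    refine Complex.Gamma_ne_zero fun k h ↦ ?_
    have := congrArg Complex.im h
    simp at this
    rw [this, abs_zero] at hu; linarith
  have h := (abs_le.mp (hC₀ x hx u hu)).1
  have hlog : -C₀ + (x - 1 / 2) * Real.log |u| + (-(π * |u|) / 2) ≤
      Real.log ‖Complex.Gamma ((x : ℂ) + u * I)‖ := by linarith
  calc Real.exp (-C₀) * |u| ^ (x - 1 / 2) * Real.exp (-(π * |u|) / 2)
      = Real.exp (-C₀ + (x - 1 / 2) * Real.log |u| + (-(π * |u|) / 2)) := by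
        rw [Real.exp_add, Real.exp_add, Real.rpow_def_of_pos hu0, mul_comm (Real.log |u|)]
    _ ≤ Real.exp (Real.log ‖Complex.Gamma ((x : ℂ) + u * I)‖) := Real.exp_le_exp.mpr hlog
    _ = ‖Complex.Gamma ((x : ℂ) + u * I)‖ := Real.exp_log (norm_pos_iff.mpr hΓ)

/-- **Vertical ratio bound, sharp exponent**: for real `a ≤ b` there is `C > 0` with
`‖Γ(x₁ + iu)‖ ≤ C |u|^{x₁ − x₂} ‖Γ(x₂ + iu)‖` for all `x₁, x₂ ∈ [a, b]` and `|u| ≥ 1` — the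
two-sided form of Stirling's `|Γ(x₁+iu)/Γ(x₂+iu)| ≍ |u|^{x₁−x₂}` (Titchmarsh (4.12.3)), e.g. for
the quotient `γ(1 − s)/γ(s)` of a functional equation on a vertical line. [folklore] -/
theorem exists_norm_Gamma_vertical_ratio_le (a b : ℝ) :
    ∃ C : ℝ, 0 < C ∧ ∀ x₁ ∈ Icc a b, ∀ x₂ ∈ Icc a b, ∀ u : ℝ, 1 ≤ |u| →
      ‖Complex.Gamma ((x₁ : ℂ) + u * I)‖ ≤
        C * |u| ^ (x₁ - x₂) * ‖Complex.Gamma ((x₂ : ℂ) + u * I)‖ := by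
  obtain ⟨C₁, hC₁, h₁⟩ := exists_norm_Gamma_vertical_le a b
  obtain ⟨c₂, hc₂, h₂⟩ := exists_norm_Gamma_vertical_ge a b
  refine ⟨C₁ / c₂, div_pos hC₁ hc₂, fun x₁ hx₁ x₂ hx₂ u hu ↦ ?_⟩
  have hu0 : 0 < |u| := by linarith
  have hup := h₁ x₁ hx₁ u hu
  have hlo := h₂ x₂ hx₂ u hu
  have hsplit : |u| ^ (x₁ - 1 / 2) = |u| ^ (x₁ - x₂) * |u| ^ (x₂ - 1 / 2) := by
    rw [← Real.rpow_add hu0]; ring_nf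
  set E : ℝ := Real.exp (-(π * |u|) / 2) with hE
  have hE0 : 0 < E := Real.exp_pos _
  set P : ℝ := |u| ^ (x₂ - 1 / 2) * E with hPdef
  have hP : P ≤ ‖Complex.Gamma ((x₂ : ℂ) + u * I)‖ / c₂ := by
    rw [le_div_iff₀ hc₂, hPdef]; linarith [hlo]
  calc ‖Complex.Gamma ((x₁ : ℂ) + u * I)‖ ≤ C₁ * |u| ^ (x₁ - 1 / 2) * E := hup
    _ = C₁ * |u| ^ (x₁ - x₂) * P := by rw [hsplit, hPdef]; ring
    _ ≤ C₁ * |u| ^ (x₁ - x₂) * (‖Complex.Gamma ((x₂ : ℂ) + u * I)‖ / c₂) :=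
        mul_le_mul_of_nonneg_left hP (by positivity)
    _ = C₁ / c₂ * |u| ^ (x₁ - x₂) * ‖Complex.Gamma ((x₂ : ℂ) + u * I)‖ := by ring

end GammaStirling

end Literature.Analysis.SpecialFunctions

end
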